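import Literature.Topology.FourManifolds.MorseSingleMinimumProofs
import Literature.Topology.FourManifolds.NiceMorseFunctionsProofs
import Literature.Topology.FourManifolds.SphereMorseCount
import Literature.Topology.FourManifolds.MorseTwoCriticalPoints
import Literature.Topology.FourManifolds.AkbulutKirbyCerfReduction
import Literature.Topology.FourManifolds.HomotopyS4CompactProofs
import Literature.Topology.FourManifolds.HomotopyS4OrientableProofs
import Literature.AlgebraicTopology.SingularHomology.SingularChains
import Literature.AlgebraicTopology.SingularHomology.CellsAttachmentEuler
import HarnessLib

/-!
# Stub `stub_propertyRClosing` of line `exchange-recognition` for crux `ConvexBisection.AcyclicBisectionRigidity`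
(item stmt-SmoothPoincare4-10507, route route-SmoothPoincare4-ConvexBisection)

**A homotopy `4`-sphere carrying a Morse function without critical points of index `1` and with
at most one critical point of index `2` is diffeomorphic to `S⁴`**, CONDITIONALLY on
* `Literature.Topology.FourManifolds.cerf_twistedSphere_four` (Cerf 1968, `Γ₄ = 0`; named fact
  of the tree, fed in as a leading hypothesis exactly as in crux 4's landed `stub_ballHalf`), and
* the hypothesis `hR` — Property R closes the trace, GLUING FORM = the registered stub
  `stub_propertyRGluing` of this crux, VERBATIM the registered stub `stub_propertyRClosing` of crux 4's
  line `property-r-mazur-halves` (item stmt-SmoothPoincare4-3546): a closed `4`-manifold glued from a compact `(1,0,1)` two-handlebody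
  and a compact connected orientable `(1,1)` one-handlebody is `S⁴` (in print: the case `n = 1`
  of Gompf–Scharlemann–Thompson 2010, Prop. 9.2 = Gabai's Property R + Laudenbach–Poénaru).

Everything else — the Morse bookkeeping on the CLOSED manifold, the content proper of this stub
over crux 4's — is PROVED from theorems of the tree (axiom closure `propext`, `Classical.choice`,
`Quot.sound`): `exists_isMorse_normalForm` (unconditional: one minimum by Milnor's cancellation
Thm. 8.1 — the tree's `exists_isMorse_ncard_criticalSetOfIndex_zero_add_one_eq_holds`;
`c₀ - c₁ + c₂ - c₃ + c₄ = χ(M) = χ(S⁴) = 2` by the Morse equality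
`SphereMorseCount.morseCount_eq_relEuler` and homotopy invariance of singular homology; turning
about and cancelling the superfluous maxima: a Morse function of profile `(1, c₂, c₂, 0, 1)`);
`stub_propertyRClosing_noTwoHandle` (`c₂ = 0`, conditional on Cerf ALONE: two critical points,
a twisted sphere by the tree's `IsMorse.exists_isTwistedSphere_of_ncard_criticalSet_eq_two`);
`nonempty_diffeomorph_sphere_of_profile_one` (`c₂ = 1`, conditional on the gluing form alone:
self-indexing rearrangement `exists_isSelfIndexing_criticalSet_eq_holds`, Milnor 1965 Thm. 4.8,
cut at the regular level `5/2` by `RegularSublevel.isBoundaryGluing_split` into the `(1,0,1)`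
two-handlebody `{g ≤ 5/2}` and the connected orientable `(1,1)` one-handlebody `{g ≥ 5/2}`).

## References

Gabai, JDG 26 (1987) Cor. 8.3 [GabaiJDG1987]; Laudenbach–Poénaru, BSMF 100 (1972) [LaudenbachPoenaruBSMF1972];
Gompf–Scharlemann–Thompson, G&T 14 (2010) Thm 1.1, Prop 9.2 [GompfScharlemannThompson2010]; Cerf, LNM 53 (1968)
[CerfDiffeoSphere1968]; Milnor, h-cobordism (1965) Thms 4.8, 7.4, 8.1 [MilnorHCobordism1965]; Morse theory (1963)
Thms 3.1–3.2, 4.1 [Milnor1963]; Matsumoto (2002) Thm 3.35 [Matsumoto2001].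
-/

noncomputable section

-- the prescribed namespace `Summit.<P>.<Sub>.…` duplicates `SmoothPoincare4` (P = Sub)
set_option linter.dupNamespace false

open scoped Manifold ContDiff Topology ContinuousMap
open Set Function Literature.Topology.FourManifolds Literature.AlgebraicTopology.SingularHomology

namespace Summit.SmoothPoincare4.SmoothPoincare4.Theorems.AcyclicBisectionRigidity.ExchangeRecognition

/-- Local notation: the round 4-sphere with its Mathlib manifold structure. -/
local notation "𝕊⁴" => (Metric.sphere (0 : EuclideanSpace ℝ (Fin 5)) 1)

/-- Local notation: the model space `ℝ⁴`. -/
local notation "E4" => EuclideanSpace ℝ (Fin 4)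

/-! ### The Property R closing in gluing form (registered stub `stub_propertyRGluing`, taken as hypothesis `hR`)

**Property R closes the trace (gluing form).**  Let `P` be a compact smooth `4`-manifold with
boundary carrying a Morse function adapted to `∂P` with indices `≤ 2`, exactly one critical point
of index `0`, none of index `1` and exactly one of index `2` (a knot trace `X_n(K) = 𝔻⁴ ∪_K h²`,
Milnor 1963, Thm. 3.2), and `V` a compact connected orientable smooth `4`-manifold with boundary
carrying an adapted Morse function with indices `≤ 1`, one critical point of index `0` and one of
index `1` (`V ≅ S¹ × B³`).  Then every closed `4`-manifold `X = P ∪_φ V` is diffeomorphic to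
`S⁴`: `S³_n(K) = ∂P ≅ ∂V = S¹ × S²` forces `n = 0` and, by GABAI'S PROPERTY R (Gabai 1987,
Cor. 8.3; tree named fact `isUnknot_of_isIntegralSurgery_zero`), `K` is the unknot, so
`P ≅ S² × D²` and `X ≅ S² × D² ∪_φ S¹ × B³ ≅ S⁴` for every `φ` by Laudenbach–Poénaru (tree named
facts `exists_diffeomorph_comp_incl_eq`, `nonempty_diffeomorph_of_isBoundaryGluing_twoHandlebody`) — the
case `n = 1` of Gompf–Scharlemann–Thompson 2010, Prop. 9.2 and its proof.  This statement is
VERBATIM the registered stub `stub_propertyRClosing` of crux 4's line `property-r-mazur-halves`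
(item stmt-SmoothPoincare4-3546) and is registered on THIS crux as `stub_propertyRGluing`; here it is
the explicit hypothesis `hR` of `nonempty_diffeomorph_sphere_of_profile_one` and of the stub, so that
one proof of the gluing form serves both cruxes and this file stays a pure proof (no `def`). -/

/-! ### Morse bookkeeping on a closed `4`-manifold -/

/-- **Counting critical points by index**: for a finite critical set on a `4`-manifold,
`#Crit(f) = Σ_{k ≤ 4} #Crit_k(f)` (the Morse index is at most the dimension; Milnor 1963, §3).
[cite: Milnor1963, §2–§3 (index of a nondegenerate critical point)] -/
theorem ncard_criticalSet_eq_sum {M : Type*} [TopologicalSpace M] [ChartedSpace E4 M]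
    (f : M → ℝ) (hfin : (criticalSet (𝓡 4) f).Finite) :
    (criticalSet (𝓡 4) f).ncard = ∑ k ∈ Finset.range 5, (criticalSetOfIndex (𝓡 4) f k).ncard := by
  -- adapted from `Literature.Topology.FourManifolds.ncard_criticalSet_eq_sum_ncard_criticalSetOfIndex`
  -- (`BordismFourUnorientedProofs.lean`), specialised to the model `𝓡 4`
  classical
  have hle : ∀ x, morseIndex (𝓡 4) f x ≤ 4 := fun x => by
    simpa only [finrank_euclideanSpace_fin] using morseIndex_le_finrank (𝓡 4) f x
  rw [Set.ncard_eq_toFinset_card _ hfin,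
    Finset.card_eq_sum_card_fiberwise (f := morseIndex (𝓡 4) f) (t := Finset.range 5)
      fun x _ => Finset.mem_range.2 (Nat.lt_succ_of_le (hle x))]
  refine Finset.sum_congr rfl fun k _ => ?_
  rw [← Set.ncard_coe_finset]; congr 1; ext x; simp [mem_criticalSetOfIndex]

/-- **Turning about on a `4`-manifold**: the critical points of `a - f` of index `i` are the
critical points of `f` of index `4 - i` (Milnor 1965, proof of Thm. 9.1; the tree's
`IsMorse.criticalSetOfIndex_const_sub`). [cite: MilnorHCobordism1965, proof of Thm. 9.1] -/
theorem criticalSetOfIndex_const_sub_four {M : Type*} [TopologicalSpace M] [ChartedSpace E4 M]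
    [IsManifold (𝓡 4) ∞ M] {f : M → ℝ} (hf : IsMorse (𝓡 4) f) (a : ℝ) {i j : ℕ}
    (hij : i + j = 4) :
    criticalSetOfIndex (𝓡 4) (fun y => a - f y) i = criticalSetOfIndex (𝓡 4) f j := by
  have h := hf.criticalSetOfIndex_const_sub a (k := i) (by rw [finrank_euclideanSpace_fin]; omega)
  rwa [finrank_euclideanSpace_fin, show 4 - i = j by omega] at h

/-- **Cancelling all superfluous minima, keeping the books on the `1`-handles** (Matsumoto 2002,
proof of Thm. 3.35; Milnor 1965, Thm. 8.1): on a closed connected `4`-manifold a Morse function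
with `r + 1` critical points of index `0` can be replaced by one with a single one, exactly `r`
fewer critical points of index `1` and as many of every index `k ≥ 2` (the tree's PROVED step
`exists_isMorse_ncard_criticalSetOfIndex_zero_add_one_eq_holds`, iterated).
[cite: Matsumoto2001, proof of Thm. 3.35] [cite: MilnorHCobordism1965, Thm. 8.1] -/
theorem exists_isMorse_cancel_minima (M : Type) [TopologicalSpace M] [T2Space M]
    [SecondCountableTopology M] [CompactSpace M] [ConnectedSpace M] [ChartedSpace E4 M]
    [IsManifold (𝓡 4) ∞ M] :
    ∀ (r : ℕ) (f : M → ℝ), IsMorse (𝓡 4) f → (criticalSetOfIndex (𝓡 4) f 0).ncard = r + 1 →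
      ∃ g : M → ℝ, IsMorse (𝓡 4) g ∧ (criticalSetOfIndex (𝓡 4) g 0).ncard = 1 ∧
        (criticalSetOfIndex (𝓡 4) g 1).ncard + r = (criticalSetOfIndex (𝓡 4) f 1).ncard ∧
        ∀ k, 2 ≤ k → (criticalSetOfIndex (𝓡 4) g k).ncard = (criticalSetOfIndex (𝓡 4) f k).ncard := by
  intro r
  induction r with
  | zero => exact fun f hf h0 => ⟨f, hf, h0, by simp, fun k _ => rfl⟩
  | succ r ih =>
    intro f hf h0
    obtain ⟨g₁, hg₁, h0₁, h1₁, hk₁⟩ :=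
      exists_isMorse_ncard_criticalSetOfIndex_zero_add_one_eq_holds 4 M f hf (by omega)
    obtain ⟨g, hg, h0g, h1g, hkg⟩ := ih g₁ hg₁ (by omega)
    exact ⟨g, hg, h0g, by omega, fun k hk => (hkg k hk).trans (hk₁ k hk)⟩

/-- **Normal form `(1, c₂, c₂, 0, 1)`.**  On a homotopy `4`-sphere `M`, a Morse function `F`
without critical points of index `1` can be traded for a Morse function `G` with exactly one
critical point of index `0`, as many of index `1` as `F` has of index `2`, as many of index `2`
as `F`, none of index `3` and exactly one of index `4`: `M` is compact and connected; `F` has ONE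
minimum (a second one would cancel against a `1`-handle, of which there is none);
`c₀ - c₁ + c₂ - c₃ + c₄ = χ(M) = χ(S⁴) = 2` (Morse equality, Milnor 1965 Thm. 7.4; homotopy
invariance of singular homology), so `c₄ = c₃ + 1 - c₂`; turned about, `-F` has `c₄` minima and
`c₃` critical points of index `1`, and cancelling all minima but one consumes `c₃ - c₂` of them.
[cite: Matsumoto2001, proof of Thm. 3.35] [cite: MilnorHCobordism1965, Thms. 7.4 and 8.1] -/
theorem exists_isMorse_normalForm
    (M : Type) [TopologicalSpace M] [T2Space M] [SecondCountableTopology M] [ChartedSpace E4 M]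
    [IsManifold (𝓡 4) ∞ M] (hM : M ≃ₕ 𝕊⁴)
    (F : M → ℝ) (hF : IsMorse (𝓡 4) F) (h1 : criticalSetOfIndex (𝓡 4) F 1 = ∅) :
    ∃ G : M → ℝ, IsMorse (𝓡 4) G ∧ (criticalSetOfIndex (𝓡 4) G 0).ncard = 1 ∧
      (criticalSetOfIndex (𝓡 4) G 1).ncard = (criticalSetOfIndex (𝓡 4) F 2).ncard ∧
      (criticalSetOfIndex (𝓡 4) G 2).ncard = (criticalSetOfIndex (𝓡 4) F 2).ncard ∧
      (criticalSetOfIndex (𝓡 4) G 3).ncard = 0 ∧ (criticalSetOfIndex (𝓡 4) G 4).ncard = 1 := by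
  haveI : CompactSpace M := compactSpace_of_homotopyEquiv_sphere_four_holds M hM
  haveI : PathConnectedSpace 𝕊⁴ := pathConnectedSpace_sphere (n := 4) (by norm_num)
  haveI : PathConnectedSpace M :=
    Literature.Topology.FourManifolds.pathConnectedSpace_of_homotopyEquiv hM
  have h1' : (criticalSetOfIndex (𝓡 4) F 1).ncard = 0 := by rw [h1, Set.ncard_empty]
  -- (1) one minimum; (2) `c₀ - c₁ + c₂ - c₃ + c₄ = χ(M) = χ(S⁴) = 2`
  have hc0 : (criticalSetOfIndex (𝓡 4) F 0).ncard = 1 := by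
    have hge := hF.one_le_ncard_criticalSetOfIndex_zero
    by_contra hne
    obtain ⟨g, -, -, hg1, -⟩ :=
      exists_isMorse_ncard_criticalSetOfIndex_zero_add_one_eq_holds 4 M F hF (by omega)
    omega
  have hc4 : 1 ≤ (criticalSetOfIndex (𝓡 4) F 4).ncard := hF.one_le_ncard_criticalSetOfIndex_zero_and_self.2
  have hχ : ((criticalSetOfIndex (𝓡 4) F 0).ncard : ℤ) - (criticalSetOfIndex (𝓡 4) F 1).ncard
      + (criticalSetOfIndex (𝓡 4) F 2).ncard - (criticalSetOfIndex (𝓡 4) F 3).ncard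
      + (criticalSetOfIndex (𝓡 4) F 4).ncard = 2 := by
    have hcount : ∑ k ∈ Finset.range 5,
        (-1 : ℤ) ^ k * ((criticalSetOfIndex (𝓡 4) F k).ncard : ℤ) = relEuler ℤ ℤ M ∅ :=
      SphereMorseCount.morseCount_eq_relEuler (n := 3) hF
    have hiso : relEuler ℤ ℤ M ∅ = relEuler ℤ ℤ 𝕊⁴ ∅ :=
      relEuler_eq_of_iso fun k => (relativeSingularHomology.emptyIso ℤ ℤ M k).symm ≪≫
        singularHomology.isoOfHomotopyEquiv ℤ ℤ hM k ≪≫ relativeSingularHomology.emptyIso ℤ ℤ _ k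
    rw [hiso, (finRelHomology_of_homeomorph_boundarySphere ℤ ℤ (boundarySphereHomeomorph 5)).2,
      Module.finrank_self] at hcount
    norm_num [Finset.sum_range_succ] at hcount
    linarith
  -- (3) turn about (`-F` has `c₄` minima, `c₃` points of index `1`) and cancel all minima but one
  have hturn := fun i j : ℕ => criticalSetOfIndex_const_sub_four hF 0 (i := i) (j := j)
  obtain ⟨G, hG, hG0, hG1, hGk⟩ := exists_isMorse_cancel_minima M
    ((criticalSetOfIndex (𝓡 4) F 4).ncard - 1) (fun y => 0 - F y) (hF.const_sub 0)
    (by rw [hturn 0 4 rfl]; omega)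
  refine ⟨G, hG, hG0, ?_, by rw [hGk 2 le_rfl, hturn 2 2 rfl], ?_, ?_⟩
  · rw [hturn 1 3 rfl] at hG1
    omega
  · rw [hGk 3 (by norm_num), hturn 3 1 rfl]; exact h1'
  · rw [hGk 4 (by norm_num), hturn 4 0 rfl]; exact hc0

/-! ### Profile `(1, 0, 1, 1, 1)`: the splitting `M = X_n(K) ∪_φ (S¹ × B³)` -/

/-- **One `2`-handle, reduced to the gluing form.**  A closed orientable `4`-manifold `M` with a
Morse function having exactly one critical point of each index `0, 2, 3, 4` and none of index `1`
is `S⁴`, GIVEN the gluing form `hR`: rearrange into a self-indexing Morse function `g` with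
the same critical points and indices (Milnor 1965, Thm. 4.8) and cut at the regular level `5/2`:
`P = {g ≤ 5/2}` is a compact `(1,0,1)` two-handlebody, `V = {g ≥ 5/2}` (the function `5/2 - g`)
a compact `(1,1)` one-handlebody, connected (one maximum) and orientable, `M = P ∪_{g = 5/2} V`.
[cite: MilnorHCobordism1965, Thm. 4.8 and §3] [cite: Milnor1963, Thm. 3.1] -/
theorem nonempty_diffeomorph_sphere_of_profile_one
    (hR : ∀ (P : Type) [TopologicalSpace P] [T2Space P] [SecondCountableTopology P]
      [ChartedSpace (EuclideanHalfSpace 4) P] [IsManifold (𝓡∂ 4) ∞ P] [CompactSpace P] (g : P → ℝ),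
      IsMorseAdapted (𝓡∂ 4) g →
      (∀ z, IsMCriticalPt (𝓡∂ 4) g z → morseIndex (𝓡∂ 4) g z ≤ 2) →
      (criticalSetOfIndex (𝓡∂ 4) g 0).ncard = 1 → criticalSetOfIndex (𝓡∂ 4) g 1 = ∅ →
      (criticalSetOfIndex (𝓡∂ 4) g 2).ncard = 1 →
      ∀ (V : Type) [TopologicalSpace V] [T2Space V] [SecondCountableTopology V]
      [ChartedSpace (EuclideanHalfSpace 4) V] [IsManifold (𝓡∂ 4) ∞ V] [CompactSpace V] [ConnectedSpace V],
      (∃ f : V → ℝ, IsMorseAdapted (𝓡∂ 4) f ∧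
          (∀ z, IsMCriticalPt (𝓡∂ 4) f z → morseIndex (𝓡∂ 4) f z ≤ 1) ∧
          (criticalSetOfIndex (𝓡∂ 4) f 0).ncard = 1 ∧ (criticalSetOfIndex (𝓡∂ 4) f 1).ncard = 1) →
      IsOrientable (𝓡∂ 4) V →
      ∀ (bP : BoundaryData (𝓡∂ 4) P (𝓡 3)) (bV : BoundaryData (𝓡∂ 4) V (𝓡 3))
        (φ : bP.carrier ≃ₘ⟮𝓡 3, 𝓡 3⟯ bV.carrier)
        (X : Type) [TopologicalSpace X] [T2Space X] [SecondCountableTopology X] [CompactSpace X]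
      [ChartedSpace (EuclideanSpace ℝ (Fin 4)) X] [IsManifold (𝓡 4) ∞ X],
      IsBoundaryGluing bP bV φ (𝓡 4) X →
      Nonempty (X ≃ₘ⟮𝓡 4, 𝓡 4⟯ Metric.sphere (0 : EuclideanSpace ℝ (Fin 5)) 1))
    {M : Type} [TopologicalSpace M] [T2Space M] [SecondCountableTopology M] [CompactSpace M]
    [ChartedSpace E4 M] [IsManifold (𝓡 4) ∞ M] (hMo : IsOrientable (𝓡 4) M)
    {f : M → ℝ} (hf : IsMorse (𝓡 4) f)
    (h0 : (criticalSetOfIndex (𝓡 4) f 0).ncard = 1) (h1 : (criticalSetOfIndex (𝓡 4) f 1).ncard = 0)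
    (h2 : (criticalSetOfIndex (𝓡 4) f 2).ncard = 1) (h3 : (criticalSetOfIndex (𝓡 4) f 3).ncard = 1)
    (h4 : (criticalSetOfIndex (𝓡 4) f 4).ncard = 1) :
    Nonempty (M ≃ₘ⟮𝓡 4, 𝓡 4⟯ 𝕊⁴) := by
  -- (a) rearrangement: a self-indexing Morse function with the same critical points and indices;
  -- at a critical point, `index ≤ 2 ⇒ g ≤ 2` and `3 ≤ index ⇒ 3 ≤ g`
  obtain ⟨g, hg, hsi, hcrit, hind⟩ := exists_isSelfIndexing_criticalSet_eq_holds 4 M f hf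
  have hset : ∀ k, criticalSetOfIndex (𝓡 4) g k = criticalSetOfIndex (𝓡 4) f k :=
    criticalSetOfIndex_congr hcrit hind
  have hg1 : criticalSetOfIndex (𝓡 4) g 1 = ∅ := by
    rw [← Set.ncard_eq_zero ((IsMorse.finite_criticalSet_holds hg).subset
      (criticalSetOfIndex_subset _ g 1)), hset 1, h1]
  have hlow : ∀ x, IsMCriticalPt (𝓡 4) g x → morseIndex (𝓡 4) g x ≤ 2 → g x ≤ 2 :=
    fun x hx h => by rw [hsi x hx]; exact_mod_cast h
  have hhigh : ∀ x, IsMCriticalPt (𝓡 4) g x → 3 ≤ morseIndex (𝓡 4) g x → 3 ≤ g x :=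
    fun x hx h => by rw [hsi x hx]; exact_mod_cast h
  -- (b) the level `5/2` is regular
  have hreg : IsRegularLevel (𝓡 4) g (5 / 2) := by
    refine hg.isRegularLevel fun z hz h => ?_
    rcases le_or_gt (morseIndex (𝓡 4) g z) 2 with hi | hi
    · have := hlow z hz hi; linarith
    · have := hhigh z hz hi; linarith
  -- (c) the 2-handlebody `P = {g ≤ 5/2}` with its adapted Morse function
  obtain ⟨hPa, hPcrit, hPind⟩ := RegularSublevel.morseData hg hreg
  have hPle : ∀ z, IsMCriticalPt (𝓡∂ 4)
      (fun x : RegularSublevel hreg => g (RegularSublevel.incl hreg x) + (1 - 5 / 2)) z →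
      morseIndex (𝓡∂ 4)
        (fun x : RegularSublevel hreg => g (RegularSublevel.incl hreg x) + (1 - 5 / 2)) z ≤ 2 := by
    intro z hz
    have hzc : IsMCriticalPt (𝓡 4) g (RegularSublevel.incl hreg z) := (hPcrit z).1 hz
    rw [hPind z hzc]
    show morseIndex (𝓡 4) g (RegularSublevel.incl hreg z) ≤ 2
    by_contra hgt
    linarith [RegularSublevel.apply_incl_le hreg z, hhigh _ hzc (by omega)]
  have hPcount : ∀ i, i ≤ 2 →
      (criticalSetOfIndex (𝓡∂ 4)
        (fun x : RegularSublevel hreg => g (RegularSublevel.incl hreg x) + (1 - 5 / 2)) i).ncard =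
      (criticalSetOfIndex (𝓡 4) f i).ncard := by
    intro i hi
    rw [RegularSublevel.ncard_criticalSetOfIndex hg hreg i, ← hset i]
    congr 1
    refine Set.inter_eq_left.2 fun x hx => ?_
    show g x ≤ 5 / 2
    linarith [hlow x hx.1 (by rw [hx.2]; exact hi)]
  have hP1 : criticalSetOfIndex (𝓡∂ 4)
      (fun x : RegularSublevel hreg => g (RegularSublevel.incl hreg x) + (1 - 5 / 2)) 1 = ∅ := by
    refine Set.eq_empty_iff_forall_notMem.2 fun z hz => ?_
    have hzc : IsMCriticalPt (𝓡 4) g (RegularSublevel.incl hreg z) := (hPcrit z).1 hz.1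
    have hmem : RegularSublevel.incl hreg z ∈ criticalSetOfIndex (𝓡 4) g 1 :=
      ⟨hzc, by rw [← hPind z hzc]; exact hz.2⟩
    simp [hg1] at hmem
  -- (d) the 1-handlebody `V = {g ≥ 5/2}`, presented by `5/2 - g`, with its adapted Morse function
  have hg' : IsMorse (𝓡 4) (fun y => 5 / 2 - g y) := hg.const_sub (5 / 2)
  obtain ⟨hVa, hVcrit, hVind⟩ := RegularSublevel.morseData hg' hreg.const_sub
  have hturn := fun i j : ℕ => criticalSetOfIndex_const_sub_four hg (5 / 2) (i := i) (j := j)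
  have hVle : ∀ z, IsMCriticalPt (𝓡∂ 4)
      (fun x : RegularSuperlevel hreg => 5 / 2 - g (RegularSublevel.incl hreg.const_sub x) + (1 - 0)) z →
      morseIndex (𝓡∂ 4)
        (fun x : RegularSuperlevel hreg =>
          5 / 2 - g (RegularSublevel.incl hreg.const_sub x) + (1 - 0)) z ≤ 1 := by
    intro z hz
    have hzc' : IsMCriticalPt (𝓡 4) (fun y => 5 / 2 - g y) (RegularSublevel.incl hreg.const_sub z) :=
      (hVcrit z).1 hz
    have hzc : IsMCriticalPt (𝓡 4) g (RegularSublevel.incl hreg.const_sub z) :=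
      (isMCriticalPt_const_sub_iff (5 / 2) (hg.contMDiff.mdifferentiableAt (by simp))).1 hzc'
    rw [hVind z hzc']
    show morseIndex (𝓡 4) (fun y => 5 / 2 - g y) (RegularSublevel.incl hreg.const_sub z) ≤ 1
    have hsum := hg.morseIndex_const_sub_add (5 / 2) hzc
    rw [finrank_euclideanSpace_fin] at hsum
    have hle : 5 / 2 - g (RegularSublevel.incl hreg.const_sub z) ≤ 0 :=
      RegularSublevel.apply_incl_le hreg.const_sub z
    by_contra hgt
    linarith [hlow _ hzc (by omega)]
  have hVcount : ∀ i j : ℕ, i + j = 4 → i ≤ 1 →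
      (criticalSetOfIndex (𝓡∂ 4)
        (fun x : RegularSuperlevel hreg =>
          5 / 2 - g (RegularSublevel.incl hreg.const_sub x) + (1 - 0)) i).ncard =
      (criticalSetOfIndex (𝓡 4) f j).ncard := by
    intro i j hij hi
    rw [RegularSublevel.ncard_criticalSetOfIndex hg' hreg.const_sub i, hturn i j hij, ← hset j]
    congr 1
    refine Set.inter_eq_left.2 fun x hx => ?_
    show 5 / 2 - g x ≤ 0
    linarith [hhigh x hx.1 (by rw [hx.2]; omega)]
  -- `V` is connected (one maximum of `g`) and orientable (as `M` is)
  obtain ⟨x₄, hx₄⟩ := Set.ncard_eq_one.1 ((congrArg Set.ncard (hset 4)).trans h4)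
  have hx₄mem : x₄ ∈ criticalSetOfIndex (𝓡 4) g 4 := by rw [hx₄]; exact Set.mem_singleton x₄
  haveI : ConnectedSpace (RegularSuperlevel hreg) :=
    RegularSublevel.connectedSpace_superlevel hg hreg (by rw [hx₄]; exact Set.subsingleton_singleton)
      ⟨x₄, by have := hhigh x₄ hx₄mem.1 (by rw [hx₄mem.2]; norm_num); linarith⟩
  have hVo : IsOrientable (𝓡∂ 4) (RegularSuperlevel hreg) :=
    RegularSublevel.isOrientable hreg.const_sub hMo
  -- (e) `M = P ∪_{g = 5/2} V`, and the gluing form of Property R concludes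
  exact hR (RegularSublevel hreg) _ hPa hPle (by rw [hPcount 0 (by norm_num), h0]) hP1
    (by rw [hPcount 2 le_rfl, h2]) (RegularSuperlevel hreg)
    ⟨_, hVa, hVle, by rw [hVcount 0 4 rfl (by norm_num), h4], by rw [hVcount 1 3 rfl le_rfl, h3]⟩
    hVo (RegularSublevel.boundaryData hreg) (RegularSublevel.boundaryData hreg.const_sub)
    (RegularSublevel.splitDiffeomorph hreg) M (RegularSublevel.isBoundaryGluing_split hreg)

/-! ### The stub -/

/-- **No `2`-handle: conditional on Cerf's `Γ₄ = 0` alone.**  A homotopy `4`-sphere carrying a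
Morse function without critical points of index `1` and `2` is diffeomorphic to `S⁴`: the normal
form `G` of `exists_isMorse_normalForm` has exactly two critical points, so `M = 𝔻⁴ ∪_φ 𝔻⁴` is a
twisted sphere (Reeb; Milnor 1963, Thm. 4.1 and Remark — the tree's
`IsMorse.exists_isTwistedSphere_of_ncard_criticalSet_eq_two`), hence `≅ S⁴` by Cerf
(`nonempty_diffeomorph_sphere_four_of_isTwistedSphere_of_cerf`).
[cite: Milnor1963, Thm. 4.1 and Remark (p. 25)] [cite: CerfDiffeoSphere1968, Γ₄ = 0] -/
theorem stub_propertyRClosing_noTwoHandle (hC : cerf_twistedSphere_four)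
    (M : Type) [TopologicalSpace M] [T2Space M] [SecondCountableTopology M] [ChartedSpace E4 M]
    [IsManifold (𝓡 4) ∞ M] (hM : M ≃ₕ 𝕊⁴)
    (F : M → ℝ) (hF : IsMorse (𝓡 4) F) (h1 : criticalSetOfIndex (𝓡 4) F 1 = ∅)
    (h2 : criticalSetOfIndex (𝓡 4) F 2 = ∅) :
    Nonempty (M ≃ₘ⟮𝓡 4, 𝓡 4⟯ 𝕊⁴) := by
  haveI : CompactSpace M := compactSpace_of_homotopyEquiv_sphere_four_holds M hM
  obtain ⟨G, hG, hG0, hG1, hG2, hG3, hG4⟩ := exists_isMorse_normalForm M hM F hF h1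
  rw [h2, Set.ncard_empty] at hG1 hG2
  have htwo : (criticalSet (𝓡 4) G).ncard = 2 := by
    rw [ncard_criticalSet_eq_sum G (IsMorse.finite_criticalSet_holds hG)]
    simp [Finset.sum_range_succ, hG0, hG1, hG2, hG3, hG4]
  obtain ⟨φ, hφ⟩ :=
    hG.exists_isTwistedSphere_of_ncard_criticalSet_eq_two (k := 3) (by norm_num) htwo
  exact nonempty_diffeomorph_sphere_four_of_isTwistedSphere_of_cerf hC hφ

/-- **Stub `stub_propertyRClosing` (conditional on Cerf's `Γ₄ = 0` and on the gluing form of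
the Property R closing).**  A homotopy `4`-sphere `M` carrying a Morse function `F` with NO
critical point of index `1` and AT MOST ONE of index `2` is diffeomorphic to `S⁴`: by
`exists_isMorse_normalForm` `M` carries a Morse function `G` of profile `(1, c₂, c₂, 0, 1)`; if
`c₂ = 0`, `M` is a twisted sphere, `≅ S⁴` by Cerf (`stub_propertyRClosing_noTwoHandle`); if
`c₂ = 1`, `-G` has profile `(1, 0, 1, 1, 1)` and `nonempty_diffeomorph_sphere_of_profile_one`
(`M = X_n(K) ∪_φ (S¹ × B³)`, Property R in gluing form) concludes.
[cite: GompfScharlemannThompson2010, Prop. 9.2 (proof), case n = 1]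
[cite: MilnorHCobordism1965, Thms. 4.8, 7.4, 8.1] [cite: CerfDiffeoSphere1968, Γ₄ = 0] -/
theorem stub_propertyRClosing (hC : cerf_twistedSphere_four)
    (hR : ∀ (P : Type) [TopologicalSpace P] [T2Space P] [SecondCountableTopology P]
      [ChartedSpace (EuclideanHalfSpace 4) P] [IsManifold (𝓡∂ 4) ∞ P] [CompactSpace P] (g : P → ℝ),
      IsMorseAdapted (𝓡∂ 4) g →
      (∀ z, IsMCriticalPt (𝓡∂ 4) g z → morseIndex (𝓡∂ 4) g z ≤ 2) →
      (criticalSetOfIndex (𝓡∂ 4) g 0).ncard = 1 → criticalSetOfIndex (𝓡∂ 4) g 1 = ∅ →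
      (criticalSetOfIndex (𝓡∂ 4) g 2).ncard = 1 →
      ∀ (V : Type) [TopologicalSpace V] [T2Space V] [SecondCountableTopology V]
      [ChartedSpace (EuclideanHalfSpace 4) V] [IsManifold (𝓡∂ 4) ∞ V] [CompactSpace V] [ConnectedSpace V],
      (∃ f : V → ℝ, IsMorseAdapted (𝓡∂ 4) f ∧
          (∀ z, IsMCriticalPt (𝓡∂ 4) f z → morseIndex (𝓡∂ 4) f z ≤ 1) ∧
          (criticalSetOfIndex (𝓡∂ 4) f 0).ncard = 1 ∧ (criticalSetOfIndex (𝓡∂ 4) f 1).ncard = 1) →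
      IsOrientable (𝓡∂ 4) V →
      ∀ (bP : BoundaryData (𝓡∂ 4) P (𝓡 3)) (bV : BoundaryData (𝓡∂ 4) V (𝓡 3))
        (φ : bP.carrier ≃ₘ⟮𝓡 3, 𝓡 3⟯ bV.carrier)
        (X : Type) [TopologicalSpace X] [T2Space X] [SecondCountableTopology X] [CompactSpace X]
      [ChartedSpace (EuclideanSpace ℝ (Fin 4)) X] [IsManifold (𝓡 4) ∞ X],
      IsBoundaryGluing bP bV φ (𝓡 4) X →
      Nonempty (X ≃ₘ⟮𝓡 4, 𝓡 4⟯ Metric.sphere (0 : EuclideanSpace ℝ (Fin 5)) 1))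
    (M : Type) [TopologicalSpace M] [T2Space M] [SecondCountableTopology M] [ChartedSpace E4 M]
    [IsManifold (𝓡 4) ∞ M] (hM : M ≃ₕ 𝕊⁴)
    (F : M → ℝ) (hF : IsMorse (𝓡 4) F) (h1 : criticalSetOfIndex (𝓡 4) F 1 = ∅)
    (h2 : (criticalSetOfIndex (𝓡 4) F 2).ncard ≤ 1) :
    Nonempty (M ≃ₘ⟮𝓡 4, 𝓡 4⟯ 𝕊⁴) := by
  haveI : CompactSpace M := compactSpace_of_homotopyEquiv_sphere_four_holds M hM
  have hfin2 : (criticalSetOfIndex (𝓡 4) F 2).Finite :=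
    (IsMorse.finite_criticalSet_holds hF).subset (criticalSetOfIndex_subset _ F 2)
  rcases Nat.le_one_iff_eq_zero_or_eq_one.1 h2 with hc2 | hc2
  · -- `c₂ = 0`: Cerf alone
    exact stub_propertyRClosing_noTwoHandle hC M hM F hF h1 ((Set.ncard_eq_zero hfin2).1 hc2)
  · -- `c₂ = 1`: `-G` has profile `(1, 0, 1, 1, 1)`
    have hMo : IsOrientable (𝓡 4) M := isOrientable_of_homotopyEquiv_sphere_four_holds M hM
    obtain ⟨G, hG, hG0, hG1, hG2, hG3, hG4⟩ := exists_isMorse_normalForm M hM F hF h1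
    rw [hc2] at hG1 hG2
    have hturn := fun i j : ℕ => criticalSetOfIndex_const_sub_four hG 0 (i := i) (j := j)
    refine nonempty_diffeomorph_sphere_of_profile_one hR hMo (hG.const_sub 0) ?_ ?_ ?_ ?_ ?_
    · rw [hturn 0 4 rfl]; exact hG4
    · rw [hturn 1 3 rfl]; exact hG3
    · rw [hturn 2 2 rfl]; exact hG2
    · rw [hturn 3 1 rfl]; exact hG1
    · rw [hturn 4 0 rfl]; exact hG0

end Summit.SmoothPoincare4.SmoothPoincare4.Theorems.AcyclicBisectionRigidity.ExchangeRecognition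

end
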